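import Summits.ResolutionOfSingularities.ResolutionOfSingularities.Theorems.FrobeniusClosingSteerStrippedThreadChainExistsH
import Summits.ResolutionOfSingularities.ResolutionOfSingularities.Theorems.FrobeniusClosingSteerNoSingularCarrierRun
import Summits.ResolutionOfSingularities.ResolutionOfSingularities.Theorems.FrobeniusClosingSteerRadicandLocalization
import Mathlib.Data.Nat.Nth
import HarnessLib

/-!
# Point tails: the eternal isolated stripped radicand chain of an F-B♮ tail (Θ♮ engine; Theses-free, def-free)

W4.1, crux `Steer` (stmt-ResolutionOfSingularities-16345), §σ2.26 v2 re-cut (res-L0-w41-strat-2 060f6b05f5dedd2c), F-B♮ side: the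
packaging piece Θ♮ `PointTailChainTwoN` (res-L0-w41-plan-1 RULING 100 → res-D-pv-011 AS res-L0-w41-stub-7). Along a σ_top-steered run
whose tail has (i) only finitely many positive steps of height `≥ 2`, (ii) infinitely many positive steps, (iii) point steps beyond every
stage, (iv) multiplicity `p` at the point steps (from HIGH), (v) ISOLATED torsor singularity at the point steps, and whose members have
(vi) enough cleaning derivations (H, res-D-pv-004's (L7)) and (vii) PERFECT residue fields (ZeroDim + `k` perfect,
`MembersPerfectResidue`), the members AT THE POINT STEPS form an eternal isolated stripped radicand chain carrying H and perfectness — so the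
body of `NoEternalStrippedRadicandChainHP p n` FAILS (`PointTail.not_noEternalStrippedChainHP_of_pointTail`).

This is the Θ1♭ engine (res-D-pv-003 p524822 / existential form p526785, corollaries `…ChainExistsH`) run on the TRIVIAL thread: thread
primes `W m := 𝔪_{R m}`, visits = the point steps beyond the three thresholds, hits = the strips (every positive step of the tail: height
`≤ 1` by (i), a singular prime by σ_top permissibility); the germs at the visits are the members themselves (`(R i)_{𝔪} = R i`), so H and
perfectness are read off the members. One level simpler than Θ1♭ (no localisation at thread primes), as strat-2's docstring says.
Hypothesis (iii) «point steps recur» is kept EXPLICIT here (a tail of strips only is excluded separately). OURS (the W4.1 engine).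
[cite: Cutkosky2014, §2.1] [cite: NovacoskiSpivakovsky2014, Def. 2.11] [cite: Matsumura1987, Thm. 19.3, Thm. 20.3]
-/

noncomputable section

-- `Summit.<S>.<S>.…` duplicates the summit name by design (single-problem summit).
set_option linter.dupNamespace false

open Polynomial IsLocalRing Literature.AlgebraicGeometry.Resolution

namespace Summit.ResolutionOfSingularities.ResolutionOfSingularities.Theorems.SwitchingDichotomy.PointTail

variable {k : Type} {K : Type} [Field k] [Field K] [Algebra k K]

/-- The germ of a local subring `R ⊆ K` at its maximal ideal, in the `locChar` currency, is `R` itself. [folklore] -/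
theorem eq_of_locChar_maximalIdeal {R T : Subring K} [IsLocalRing R]
    (hT : ∀ z : K, z ∈ T ↔ ∃ a b : R, b ∉ maximalIdeal R ∧ z = (a : K) / b) : T = R := by
  ext z
  rw [hT z]
  constructor
  · rintro ⟨a, b, hb, rfl⟩
    have hbu : IsUnit b := by
      by_contra h
      exact hb ((IsLocalRing.mem_maximalIdeal b).mpr h)
    obtain ⟨hb0, hbinv⟩ := (isUnit_subring_iff_inv_mem b).mp hbu
    rw [div_eq_mul_inv]
    exact R.mul_mem a.2 hbinv
  · intro hz
    refine ⟨⟨z, hz⟩, 1, fun h => ?_, by simp⟩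
    exact (IsLocalRing.maximalIdeal.isMaximal R).ne_top (Ideal.eq_top_of_isUnit_mem _ h isUnit_one)

/-- **Θ♮ engine — the point-step members of an F-B♮ tail form an eternal isolated stripped radicand chain with H and perfect residue
fields; hence the body of `NoEternalStrippedRadicandChainHP p n` fails.** See the module docstring for the hypotheses. OURS.
[cite: Cutkosky2014, §2.1] [cite: NovacoskiSpivakovsky2014, Def. 2.11] [cite: Matsumura1987, Thm. 19.3, Thm. 20.3] -/
theorem not_noEternalStrippedChainHP_of_pointTail (p : ℕ) [hp : Fact p.Prime] [CharP K p]
    (O : ValuationSubring K) (A₀ : Subalgebra k K) (h₀ : A₀.toSubring ≤ O.toSubring) (hfg : A₀.FG)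
    (R : ℕ → Subring K) (P : (i : ℕ) → Ideal (R i)) (s : ℕ → K) (n : ℕ)
    (hR0 : R 0 = locAtCentre A₀.toSubring O)
    (hbl : ∀ i, IsLocalBlowupAlong O (R i) (P i) (R (i + 1)))
    (hst : ∀ i, ∃ x g : K, ((∃ hx : x ∈ R i, (⟨x, hx⟩ : R i) ∈ P i) ∧ x ≠ 0 ∧
      ∀ y : R i, y ∈ P i → O.valuation (y : K) ≤ O.valuation x) ∧ g ∈ R i ∧ s i = x * s (i + 1) + g)
    (hsp : ∀ i, s i ^ p ∈ R i)
    (hregR : ∀ i, IsRegularLocalRing (R i))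
    (hdim : ∀ i, ringKrullDim (R i) = n)
    (hvis : ∀ i, (∃ _ : IsLocalRing (R i), P i ≠ maximalIdeal (R i)) →
      (P i).IsPrime ∧
      (∀ _ : (P i).IsPrime, ¬ IsRegularLocalRing (AdjoinRoot ((X : (Localization.AtPrime (P i))[X]) ^ p -
          C (algebraMap (R i) (Localization.AtPrime (P i)) ⟨s i ^ p, hsp i⟩)))))
    (hpt : ∀ i₀ : ℕ, ∃ i, i₀ ≤ i ∧ ∃ _ : IsLocalRing (R i), P i = maximalIdeal (R i))
    (hpos : ∀ i₀ : ℕ, ∃ i, i₀ ≤ i ∧ ∃ _ : IsLocalRing (R i), P i ≠ maximalIdeal (R i))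
    (hfin2 : ∃ m₀ : ℕ, ∀ m, m₀ ≤ m → (∃ _ : IsLocalRing (R m), P m ≠ maximalIdeal (R m)) → (P m).height ≤ 1)
    (hmult : ∃ i₀ : ℕ, ∀ i, i₀ ≤ i → (∃ _ : IsLocalRing (R i), P i = maximalIdeal (R i)) →
      ∃ g : R i, (⟨s i ^ p, hsp i⟩ : R i) - g ^ p ∈ P i ^ p)
    (hiso : ∃ i₀ : ℕ, ∀ i, i₀ ≤ i → (∃ _ : IsLocalRing (R i), P i = maximalIdeal (R i)) →
      ∀ (Q : Ideal (AdjoinRoot ((X : (R i)[X]) ^ p - C (⟨s i ^ p, hsp i⟩ : R i)))) [Q.IsPrime],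
        (∃ Q' : Ideal (AdjoinRoot ((X : (R i)[X]) ^ p - C (⟨s i ^ p, hsp i⟩ : R i))), Q'.IsPrime ∧ Q < Q') →
        IsRegularLocalRing (Localization.AtPrime Q))
    (hCD : ∀ (S S' : Subring K) [IsRegularLocalRing S] [IsRegularLocalRing S'] (hle : S ≤ S'),
      IsQuadraticTransform S S' → ∀ (ξ : K) (hξ : ξ ∈ S'),
      Ideal.span ((fun y : S => (⟨(y : K), hle y.2⟩ : S')) '' (maximalIdeal S : Set S)) = Ideal.span {(⟨ξ, hξ⟩ : S')} →
      ∀ (f G F : K), f ∈ S → G ∈ S' → F ∈ S' → ∀ e : ℕ, 1 ≤ e → f - G ^ p = ξ ^ (p * e) * F →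
      ∃ g h : K, g ∈ S ∧ h ∈ S' ∧ G = g + ξ ^ e * h)
    (hH : ∀ (i : ℕ) (T : Subring K) [IsLocalRing T], T = R i → ∀ f g : T,
      (∀ N : ℕ, (∀ h : T, f - h ^ p ∉ maximalIdeal T ^ (N + 1)) → f - g ^ p ∈ maximalIdeal T ^ N →
        ∃ D : Derivation ℤ T T, D f ∉ maximalIdeal T ^ N ∨
          ((∀ y ∈ maximalIdeal T, D y ∈ maximalIdeal T) ∧ D f ∉ maximalIdeal T ^ (N + 1))))
    (hperf : ∀ (i : ℕ) (T : Subring K) [IsLocalRing T], T = R i → PerfectField (IsLocalRing.ResidueField T)) :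
    ¬ (∀ (L : Type) [Field L] [CharP L p] (S : ℕ → Subring L) [∀ m, IsLocalRing (S m)]
        (hle : ∀ m, S m ≤ S (m + 1)) (f g : ∀ m, S m) (x : ∀ m, S (m + 1)) (e : ℕ → ℕ) (_he : ∀ m, 1 ≤ e m)
        (_hinf : ∀ m₀, ∃ m, m₀ ≤ m ∧ 2 ≤ e m),
        (∀ m, IsRegularLocalRing (S m)) → (∀ m, IsExcellentRing (S m)) → (∀ m, ringKrullDim (S m) = n) →
        (∀ m, IsQuadraticTransform (S m) (S (m + 1))) →
        (∀ m, Ideal.span ((fun y : S m => (⟨(y : L), hle m y.2⟩ : S (m + 1))) '' (maximalIdeal (S m) : Set (S m)))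
            = Ideal.span {x m}) →
        (∀ m, ((f (m + 1) : S (m + 1)) : L) * ((x m : S (m + 1)) : L) ^ (p * e m) =
            ((f m : S m) : L) - ((g m : S m) : L) ^ p) →
        (∀ m, ∃ h : S m, f m - h ^ p ∈ maximalIdeal (S m) ^ p) →
        (∀ m, ∀ N : ℕ, (∀ h : S m, f m - h ^ p ∉ maximalIdeal (S m) ^ (N + 1)) →
          f m - (g m) ^ p ∈ maximalIdeal (S m) ^ N →
          ∃ D : Derivation ℤ (S m) (S m), D (f m) ∉ maximalIdeal (S m) ^ N ∨
            ((∀ y ∈ maximalIdeal (S m), D y ∈ maximalIdeal (S m)) ∧ D (f m) ∉ maximalIdeal (S m) ^ (N + 1))) →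
        (∀ m, PerfectField (IsLocalRing.ResidueField (S m))) →
        (∀ m, ∀ (Q : Ideal (AdjoinRoot ((X : (S m)[X]) ^ p - C (f m)))) [Q.IsPrime],
            (∃ Q' : Ideal (AdjoinRoot ((X : (S m)[X]) ^ p - C (f m))), Q'.IsPrime ∧ Q < Q') →
            IsRegularLocalRing (Localization.AtPrime Q)) →
        False) := by
  classical
  haveI hloc : ∀ i, IsLocalRing (R i) := fun i => by haveI := hregR i; infer_instance
  have hmono : Monotone R := monotone_nat_of_le_succ fun i => (hbl i).isLocalBlowup.le
  -- ### members are their own local rings at the centre of `O`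
  have hRO0 : R 0 ≤ O.toSubring := by rw [hR0]; exact locAtCentre_le h₀
  have hloc0 : locAtCentre (R 0) O = R 0 := by rw [hR0, locAtCentre_locAtCentre]
  have hrun := NoSingularCarrier.le_and_locAtCentre_eq_of_run R P hRO0 hloc0 hbl
  have hval : ∀ i (a : R i), a ∈ maximalIdeal (R i) ↔ O.valuation (a : K) < 1 := fun i =>
    NoSingularCarrier.mem_maximalIdeal_iff_of_locAtCentre_eq (hrun i).1 (hrun i).2
  -- ### the thresholds and the visits = point steps beyond them
  obtain ⟨m₀, hm₀⟩ := hfin2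
  obtain ⟨i₁, hi₁⟩ := hmult
  obtain ⟨i₂, hi₂⟩ := hiso
  set N₀ : ℕ := m₀ + i₁ + i₂ with hN₀
  let J : Set ℕ := {i | N₀ ≤ i ∧ P i = maximalIdeal (R i)}
  have hJ : J.Infinite := by
    refine Set.infinite_of_forall_exists_gt fun a => ?_
    obtain ⟨i, hi, _, hP⟩ := hpt (N₀ + a + 1)
    exact ⟨i, ⟨by omega, hP⟩, by omega⟩
  have hjmono : StrictMono (Nat.nth (· ∈ J)) := Nat.nth_strictMono hJ
  set j : ℕ → ℕ := Nat.nth (· ∈ J) with hjdef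
  have hjmem : ∀ k, j k ∈ J := fun k => Nat.nth_mem_of_infinite hJ k
  have hjN₀ : ∀ k, N₀ ≤ j k := fun k => (hjmem k).1
  have hjP : ∀ k, P (j k) = maximalIdeal (R (j k)) := fun k => (hjmem k).2
  have hjsurj : ∀ m ∈ J, ∃ k, j k = m := fun m hm => ⟨Nat.count (· ∈ J) m, Nat.nth_count hm⟩
  -- a non-visit beyond `j 0` is a positive step
  have hposnv : ∀ m, j 0 ≤ m → (∀ k, m ≠ j k) → P m ≠ maximalIdeal (R m) := by
    intro m hm hnv hP
    obtain ⟨kk, hkk⟩ := hjsurj m ⟨(hjN₀ 0).trans hm, hP⟩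
    exact hnv kk hkk.symm
  -- ### the engine on the trivial thread `W m = 𝔪_{R m}`
  refine StrippedThreadExists.not_noEternalStrippedChainHP_of_thread p O A₀ h₀ hfg R P s n hR0 hbl hst hsp hregR
    j hjmono (fun m => maximalIdeal (R m)) (fun m _ => (IsLocalRing.maximalIdeal.isMaximal (R m)).isPrime)
    (fun k => (hjP k).symm) (fun m _ => ⟨hmono (Nat.le_succ m), ?_⟩) (fun m hm hnv _ => ?_) (fun m₁ => ?_)
    (fun k => ?_) (fun k => ?_) (fun k => ?_) (fun k Q _ hQ => ?_) hCD (fun m T _ hT f g => ?_) (fun m T _ hT => ?_)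
  · -- `hWcomap`: maximal ideals contract along the tower (both members are dominated by `O`)
    ext y
    rw [Ideal.mem_comap, hval (m + 1), hval m]
    rfl
  · -- `hhit`: a non-visit beyond `j 0` is a positive step of height `≤ 1`, and a singular prime
    have hne : P m ≠ maximalIdeal (R m) := hposnv m hm hnv
    obtain ⟨hPm, hsing⟩ := hvis m ⟨hloc m, hne⟩
    exact ⟨hPm, hm₀ m (by have := hjN₀ 0; omega) ⟨hloc m, hne⟩, hsing hPm⟩
  · -- `hinf`: positive steps recur, and they are non-visits contained in `𝔪`
    obtain ⟨m, hm, _, hne⟩ := hpos (m₁ + j 0)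
    refine ⟨m, by omega, fun kk hkk => ?_, ?_⟩
    · subst hkk
      exact hne (hjP kk)
    · haveI := (hvis m ⟨hloc m, hne⟩).1
      exact IsLocalRing.le_maximalIdeal (Ideal.IsPrime.ne_top inferInstance)
  · -- `hht`: the height of `𝔪` is the dimension `n`
    rw [hjP k]
    have h3 : ((maximalIdeal (R (j k))).height : WithBot ℕ∞) = (n : ℕ∞) := by
      rw [IsLocalRing.maximalIdeal_height_eq_ringKrullDim, hdim]; rfl
    exact WithBot.coe_injective h3
  · -- `hquot`: `R ⧸ 𝔪` is a field
    rw [hjP k]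
    exact NoSingularCarrier.isRegularLocalRing_quotient_maximalIdeal (R (j k))
  · -- `hmult`: multiplicity `p` at the point steps
    exact hi₁ (j k) (by have := hjN₀ k; omega) ⟨hloc _, hjP k⟩
  · -- `hmin`: isolatedness at the point steps, read on a prime `Q < 𝔪`
    have hQne : Q ≠ maximalIdeal (R (j k)) := by rw [← hjP k]; exact hQ.ne
    haveI := hregR (j k)
    obtain ⟨P', hP', hunder, Q', hQ', hlt⟩ :=
      RadicandLocalization.exists_prime_under_eq_of_ne_maximalIdeal p (⟨s (j k) ^ p, hsp (j k)⟩ : R (j k)) Q hQne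
    haveI := hP'
    have hregP' := hi₂ (j k) (by have := hjN₀ k; omega) ⟨hloc _, hjP k⟩ P' ⟨Q', hQ', hlt⟩
    exact (RadicandLocalization.isRegularLocalRing_localization_atPrime_iff_of_under_eq p _ Q P' hunder).mp hregP'
  · -- `hL7`: the germ at a visit is the member itself
    have hT' : ∀ z : K, z ∈ T ↔ ∃ a b : R (j (m + 1)), b ∉ maximalIdeal (R (j (m + 1))) ∧ z = (a : K) / b := by
      intro z; rw [hT z, hjP (m + 1)]
    exact hH (j (m + 1)) T (eq_of_locChar_maximalIdeal hT') f g
  · -- `hperf`: likewise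
    have hT' : ∀ z : K, z ∈ T ↔ ∃ a b : R (j (m + 1)), b ∉ maximalIdeal (R (j (m + 1))) ∧ z = (a : K) / b := by
      intro z; rw [hT z, hjP (m + 1)]
    exact hperf (j (m + 1)) T (eq_of_locChar_maximalIdeal hT')

end Summit.ResolutionOfSingularities.ResolutionOfSingularities.Theorems.SwitchingDichotomy.PointTail

end
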